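import Literature.Probability.Percolation.KozmaNitzanCorridor
import HarnessLib

/-!
# FRONTIER TRANSPLANT, binder 2 (TP_FK) — T4-SLAB (D): the two DEFINITIONS of the slab Step-IV supplier —
# the gate predicate `slabGate` of the frozen collar and the shape class `IsBoxGeom` of the record's target families

Support file (`--supports stmt-CriticalPhenomena-4575`, helper) of the FRONTIER TRANSPLANT sub-cell (`fk-continuity/transplant/`,
seat `prim-bschramm-fkt-p1`); builds on p205010 (kernel theorem, internal audit signed; external expert review pending).
2 definitions (`slabGate`, `IsBoxGeom`; `--kind definition`) · 0 named facts · 0 sorries · standard axioms. File 1/18 of the bytes-first package (R60 (3)(β)) of the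
UNFUNDED memo row `T4-SLAB [g122, R60]` (re-described R62 (E)); proposable only on a coordinator ruling.
Registered R63 (cell INBOX l.4709, 2026-08-23); registry row T4s; lead label T4s-01 (fkt-lead L22, l.4677).

HONEST FRAMING (page 1, cell rule). The transplant's theorem of record `ufsc0_of_freeBoundaryHypothesis_r3` (p248245) is
CONDITIONAL on FH AND on TP_FK = `KNFreeTargetHittable d q p`, both OPEN at the same `p` for `q > 1` near `p_c(q)` (⇔ GRC
Conj. (5.103) via K1; barrier note `Literature.Barriers.CriticalPhenomena.SamePFreeBoundaryCriteria`, FBN-01, cited first);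
the transplant is a typed reduction, not a proof of FK continuity. THIS FILE only DEFINES two displayed predicates used by
the slab Step-IV supplier (`KNFreeSlabSupplier.lean`: `FKStepIVAt q p δ H M j₀ R₀` for families `H` of centred box
geometries, from `Π(p, L)`): neither is a hypothesis of the record, a binder, or `_r4`; `_r3` « 2 / 0 ☑ », n_open = 2,
BINDER-OWNERS, FO-19 NO-GO unchanged; nothing at `p ↓ p_c(q)` (K1/C5).

* `slabGate Lo Hi T Pg Pbig g₀ x` — `x` is a GATE of the level box `Icc Lo Hi` with collar width `T`: at depth `2 … T`
  below some face `(f, ±)`, at depth `> T` in every other direction, with one transverse coordinate `≡ g₀ (mod Pg)` and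
  all remaining transverse coordinates `≡ g₀ (mod Pbig)`. The frozen set of the slab Step IV is the collar MINUS the gates.
* `IsBoxGeom g` — CENTRED BOX GEOMETRY: `Q ⊇ [-1, 1]^d`, `F ⊆ Q` flat in one direction `a` at a face of `Q`, and in every
  other direction `F`'s shadow contains `0` and has side `≥ 1`. `isBoxGeom_of_mem_qfList` (quarter faces),
  `isBoxGeom_of_mem_elongList` (elongated faces, aspect `K ≥ 1`): the record's two target families are in the class.

## References

* G. Kozma, S. Nitzan, arXiv:2401.12397 (2024), §4 p. 16 (geometries), Lemma 9, Lemma 10 Step IV (pp. 19–21),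
  Lemma 11 (p. 22) [KozmaNitzan2024].
* G. Grimmett, *The Random-Cluster Model*, Springer 2006, §5.7 (slabs), Conj. (5.103) [Grimmett2006].
-/

noncomputable section

namespace Summit.CriticalPhenomena.PercolationContinuityZ3.Theorems.FK

open scoped Classical
open Literature.Probability.Percolation Literature.Probability.LatticeModels
open Literature.Probability.Percolation.KozmaNitzan

variable {d : ℕ}

/-- **Gate vertex** of the level box `Icc Lo Hi` with collar width `T` and residue pattern `(Pg, Pbig, g₀)`: at depth
`2 … T` below some face `(f, ±)`, at depth `> T` in every other direction, one transverse coordinate `≡ g₀ (mod Pg)` and all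
remaining transverse coordinates `≡ g₀ (mod Pbig)`. [cite: KozmaNitzan2024, §4 pp. 19–21 (Step IV: the shell S and its crossings)] -/
def slabGate (Lo Hi : Site d) (T Pg Pbig : ℕ) (g₀ : ℤ) (x : Site d) : Prop :=
  ∃ f : Fin d, ((2 ≤ Hi f - x f ∧ Hi f - x f ≤ T) ∨ (2 ≤ x f - Lo f ∧ x f - Lo f ≤ T)) ∧
    (∀ b, b ≠ f → Lo b + T + 1 ≤ x b ∧ x b ≤ Hi b - T - 1) ∧
    ∃ c' : Fin d, c' ≠ f ∧ x c' ≡ g₀ [ZMOD Pg] ∧ ∀ b, b ≠ f → b ≠ c' → x b ≡ g₀ [ZMOD Pbig]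

/-- **Centred box geometry** (the shape class of the record's target families): `Q ⊇ [-1,1]^d`, `F ⊆ Q` flat in one
direction `a` at a face of `Q`, and in every other direction `F`'s shadow contains the centre and has side `≥ 1`
(quarter faces `{±1} × [0,1]^{d-1}`-type, elongated faces `{K} × [-1,1]^{d-1}`). [cite: KozmaNitzan2024, §4 p. 16, Lemma 9, Lemma 11] -/
structure IsBoxGeom (g : Geom d) : Prop where
  loQ_le : ∀ b, g.loQ b ≤ -1
  one_le_hiQ : ∀ b, 1 ≤ g.hiQ b
  F_sub_Q : ∀ b, g.loQ b ≤ g.loF b ∧ g.hiF b ≤ g.hiQ b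
  flat : ∃ a, (g.loF a = g.loQ a ∨ g.hiF a = g.hiQ a) ∧ g.loF a = g.hiF a ∧
    ∀ b, b ≠ a → g.loF b ≤ 0 ∧ 0 ≤ g.hiF b ∧ g.loF b + 1 ≤ g.hiF b

/-- The quarter-face geometries are centred box geometries. [cite: KozmaNitzan2024, §4 Lemma 9 (p. 16)] -/
theorem isBoxGeom_of_mem_qfList {g : Geom d} (hg : g ∈ qfList d) : IsBoxGeom g := by
  obtain ⟨x, -, rfl⟩ := List.mem_map.1 hg
  obtain ⟨a, τ⟩ := x
  refine ⟨fun b => by simp [qfGeom], fun b => by simp [qfGeom], fun b => ?_, ⟨a, ?_, by simp [qfGeom], fun b hb => ?_⟩⟩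
  · simp only [qfGeom]
    by_cases hb : b = a
    · subst hb; simp only [if_true]; rcases Int.units_eq_one_or (τ b) with h | h <;> simp [h]
    · simp only [if_neg hb]
      rcases Int.units_eq_one_or (τ b) with h | h <;> simp [h]
  · simp only [qfGeom, if_true]
    rcases Int.units_eq_one_or (τ a) with h | h <;> simp [h]
  · simp only [qfGeom, if_neg hb]
    rcases Int.units_eq_one_or (τ b) with h | h <;> simp [h]

/-- The elongated geometries (aspect `K ≥ 1`) are centred box geometries. [cite: KozmaNitzan2024, §4 Lemma 11 (p. 22)] -/
theorem isBoxGeom_of_mem_elongList {K : ℕ} (hK : 1 ≤ K) {g : Geom d} (hg : g ∈ elongList d K hK) : IsBoxGeom g := by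
  obtain ⟨x, -, rfl⟩ := List.mem_map.1 hg
  obtain ⟨a, σ⟩ := x
  have hK' : (1 : ℤ) ≤ K := by exact_mod_cast hK
  have key : ∀ b : Fin d,
      (elongGeom a σ K hK).loQ b = (if b = a then (if (σ : ℤ) = 1 then -1 else -(K : ℤ)) else -1) ∧
      (elongGeom a σ K hK).hiQ b = (if b = a then (if (σ : ℤ) = 1 then (K : ℤ) else 1) else 1) ∧
      (elongGeom a σ K hK).loF b = (if b = a then (if (σ : ℤ) = 1 then (K : ℤ) else -(K : ℤ)) else -1) ∧
      (elongGeom a σ K hK).hiF b = (if b = a then (if (σ : ℤ) = 1 then (K : ℤ) else -(K : ℤ)) else 1) := by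
    intro b
    simp only [elongGeom, sLo, sHi, Pi.zero_apply, zero_add, zero_sub]
    by_cases hb : b = a
    · subst hb; simp only [if_true]
      rcases units_sign σ with hs | hs
      · simp [hs]
      · have h1 : (σ : ℤ) ≠ 1 := by rw [hs]; norm_num
        simp [h1]
    · simp [hb]
  refine ⟨fun b => ?_, fun b => ?_, fun b => ?_, ⟨a, ?_, ?_, fun b hb => ?_⟩⟩
  · rw [(key b).1]; split_ifs <;> linarith
  · rw [(key b).2.1]; split_ifs <;> linarith
  · rw [(key b).1, (key b).2.1, (key b).2.2.1, (key b).2.2.2]; split_ifs <;> constructor <;> linarith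
  · rw [(key a).1, (key a).2.1, (key a).2.2.1, (key a).2.2.2]; simp only [if_true]; split_ifs
    · right; rfl
    · left; rfl
  · rw [(key a).2.2.1, (key a).2.2.2]; simp only [if_true]
  · rw [(key b).2.2.1, (key b).2.2.2]; simp only [if_neg hb]; norm_num


end Summit.CriticalPhenomena.PercolationContinuityZ3.Theorems.FK

end
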